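import Summits.BirchSwinnertonDyer.BirchSwinnertonDyer.Theorems.AdditiveKolyvaginRoadLagrangianSwitchAtP
import HarnessLib

/-!
# Route `AdditiveKolyvaginRoad`, crux `LevelKolyvaginSystemsAdditive` (item stmt-BirchSwinnertonDyer-21396, KS′):
# the one-place Lagrangian switch at `p`, part 4 — TRANSPORT along a torsion congruence `φ : E₀[p] ≅ E[p]`: the transported
# Kummer line is isotropic for EVERY Weil pairing, non-zero, and — under equal Selmer parity — EQUAL to E's Kummer line
# (cell `pub/bsd-wall`, width seat `bsd-wall-akr-p2x-w2` g3; `--supports stmt-BirchSwinnertonDyer-21396`, helper; sequel of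
# `…LagrangianSwitchAtP{Jump,Lines,}.lean`, p596759 ∕ p597649 ∕ p598027; memo `Cruxes/…/SWITCH-AT-P.md`)

WHY. The switch `natCard_selmerGroup_switch` ∕ `eq_kummer_of_isotropic_of_even_iff` (p598027) takes the second line `L′` with two
hypotheses: `L′` ISOTROPIC for `inv_{w₀}(· ∪ₑ ·)` for every Poitou–Tate family ∕ Weil pairing, and `L′ ≠ 0`. In the transfer lines
on KS′ (TRIAGE-r1 survivor A), `L′` is the Kummer line of a congruent LENDER `E₀` transported along an isomorphism of the residual
representations; this file discharges both hypotheses for such an `L′` from the isomorphism ALONE (no compatibility with chosen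
pairings is needed: any Weil datum on `E[p]` pulls back to one on `E₀[p]`), and states the (A1)-shape result directly for a
torsion congruence, plus the (θK)-at-`w₀` binder for global classes in the currency of the transfer socket
`nonempty_levelKolyvaginSystemP_of_torsionCongr` (w3 g2, there over `h1Equiv`; here over `galoisCohomology.map`).

WHAT (namespace `…Theorems.AdditiveKoly.LagrangianSwitchAtP`; `W`, `W₀` elliptic curves over a number field `K`;
`φ : E₀[n] → E[n]` a morphism of discrete `Γ_K`-modules = `ContIntertwiningMap` of the torsion Galois modules).
* §1 `invWeilPairing_map_map` — TRANSPORT of the local pairing: `⟨φ_* a, φ_* b⟩_{E,e} = ⟨a, b⟩_{E₀,e₀}` whenever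
  `e(φS, φT) = e₀(S, T)` (covariant naturality of the cup product, tree `ContPairing.cupProduct_map`, identity on `μₙ`);
  `invWeilPairing_eq_zero_of_mem_map_kummer` — `φ_*𝓚^{E₀}_v` is ISOTROPIC for `inv_v(· ∪ₑ ·)` for EVERY alternating Weil datum `e`
  on `E[n]` (pull `e` back along `φ`; Poonen–Rains isotropy for `E₀`); `map_kummer_ne_bot` (injectivity of `φ_{v,*}` from a left
  inverse); `natCard_localH1_eq_of_iso` (`#H¹(K_v, E₀[n]) = #H¹(K_v, E[n])`); `localization_map` (naturality `loc ∘ φ_* = φ_{v,*} ∘ loc`).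
* §2 `natCard_kummerSelmerStructure_eq` — at a PLANE place (`#H¹(K_{w₀}, E[p]) = p²`, `p ≠ 2`, perfect family) E's Kummer condition
  has order `p` (Lagrangian count); **`map_kummer_eq_kummer_of_even_iff`** — for an isomorphism `φ` (inverse `ψ`), the named PT fact,
  a plane place `w₀` for `E`, and Selmer orders `p^a` (structure `𝓚^E`) and `p^b` (structure `𝓚^E[w₀ ↦ φ_*𝓚^{E₀}_{w₀}]`) with
  `a ≡ b (mod 2)`: **`φ_*𝓚^{E₀}_{w₀} = 𝓚^E_{w₀}`**; `localization_map_mem_kummer_iff` — then for every global `y ∈ H¹(K, E₀[p])`,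
  `loc_{w₀}(φ_* y) ∈ 𝓚^E_{w₀} ↔ loc_{w₀} y ∈ 𝓚^{E₀}_{w₀}` (the (θK) binder at `w₀`).

HONEST FRAMING: theorems only; 0 definitions, 0 named facts, 0 `sorry`; CONDITIONAL on the displayed hypotheses (named PT fact =
the route's DUAL.2, the isomorphism `φ`, the plane count, the parity); E-side glue; closes nothing. Over the Heegner field `K` the
parity hypothesis is NOT available from `p`-parity (two places above the split `p`, TRIAGE-r1-1 §5): the intended use is `K := ℚ`,
the `K`-level (θK) then needs the transport `K_v ≅ ℚ_p` (not built here). BSD is not proved by any of this.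

References: [cite: PoonenRains2012, Prop. 4.10, Prop. 4.11] [cite: NeukirchSchmidtWingberg2008, I §4 (1.4.2)] [cite: MilneADT2006, Ch. I,
Cor. 2.3, Thm. 2.8, Thm. 4.10] [cite: SerreGaloisCohomology1997, I §2.2, §2.4] [cite: DokchitserDokchitserAnnals2010, Thm. 1.4].
-/

-- single-conjunct summit: `Summit.BirchSwinnertonDyer.BirchSwinnertonDyer.…` repeats the name by design
set_option linter.dupNamespace false

noncomputable section

open scoped Classical NumberField
open Function NumberField IsDedekindDomain Field WeierstrassCurve CategoryTheory
open Literature.NumberTheory.EllipticCurves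
open Literature.NumberTheory.GaloisRepresentations Literature.NumberTheory.GaloisRepresentations.DiscreteGaloisModule
  Literature.NumberTheory.GaloisCohomology
open Summit.BirchSwinnertonDyer.Rank1Residual.X11b.FiniteDuality
open Summit.BirchSwinnertonDyer.Rank1Residual.X11b.Relaxation
open Summit.BirchSwinnertonDyer.Rank1Residual.X11b.LocBridge
open Summit.BirchSwinnertonDyer.Rank1Residual.X11b
open Summit.BirchSwinnertonDyer.Rank1Residual.GaloisImage
open Summit.BirchSwinnertonDyer.Rank1Residual.X11b.Three.Koly.ZhangSupply
open Summit.BirchSwinnertonDyer.Rank1Residual.X11b.KummerPT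
open scoped ContRepresentation

namespace Summit.BirchSwinnertonDyer.BirchSwinnertonDyer.Theorems.AdditiveKoly.LagrangianSwitchAtP

variable {K : Type} [Field K] [NumberField K] (W W₀ : WeierstrassCurve K) [W.IsElliptic] [W₀.IsElliptic]

/-! ## §1 The local Weil cup-product pairing is TRANSPORTED along a morphism of torsion modules compatible with the pairings -/

section Transport

variable (n : ℕ) [NeZero n]
variable (e : W.geomTorsion n → W.geomTorsion n → AlgebraicClosure K)
  (hμ : ∀ S T, e S T ^ n = 1)
  (hadd₁ : ∀ S₁ S₂ T, e (S₁ + S₂) T = e S₁ T * e S₂ T)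
  (hadd₂ : ∀ S T₁ T₂, e S (T₁ + T₂) = e S T₁ * e S T₂)
  (hgal : ∀ (σ : absoluteGaloisGroup K) (S T : W.geomTorsion n), σ • e S T = e (σ • S) (σ • T))
  (e₀ : W₀.geomTorsion n → W₀.geomTorsion n → AlgebraicClosure K)
  (hμ₀ : ∀ S T, e₀ S T ^ n = 1)
  (hadd₁₀ : ∀ S₁ S₂ T, e₀ (S₁ + S₂) T = e₀ S₁ T * e₀ S₂ T)
  (hadd₂₀ : ∀ S T₁ T₂, e₀ S (T₁ + T₂) = e₀ S T₁ * e₀ S T₂)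
  (hgal₀ : ∀ (σ : absoluteGaloisGroup K) (S T : W₀.geomTorsion n), σ • e₀ S T = e₀ (σ • S) (σ • T))
  (inv : LocalInvariants K n)
  (φ : (W₀.torsionGaloisModule n).toContRepresentation →ⁱL (W.torsionGaloisModule n).toContRepresentation)
  (he : ∀ S T, e (φ S) (φ T) = e₀ S T)

omit [W.IsElliptic] [W₀.IsElliptic] in
include he in
/-- **Transport of the local Weil cup-product pairing.** For a morphism of discrete `Γ_K`-modules `φ : E₀[n] → E[n]` carrying
the Weil pairing `e₀` of `E₀` to the Weil pairing `e` of `E` (`e(φS, φT) = e₀(S, T)`), the induced map on `H¹(K_v, ·)`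
intertwines the pairings `inv_v(· ∪ₑ ·)`: `⟨φ_* a, φ_* b⟩_E = ⟨a, b⟩_{E₀}` (covariant naturality of the cup product,
`ContPairing.cupProduct_map`, with the identity on `μₙ`). [cite: NeukirchSchmidtWingberg2008, I §4 (1.4.2)] -/
theorem invWeilPairing_map_map
    -- cup products need the compactness of the local absolute Galois groups (binder, discharged by
    -- `absoluteGaloisGroup_compactSpace` at the call site)
    [∀ v : Place K, CompactSpace (absoluteGaloisGroup (Place.Completion v))] (v : Place K)
    (a b : galoisCohomology ((W₀.torsionGaloisModule n).toLocal v) 1) :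
    invWeilPairing W n e hμ hadd₁ hadd₂ hgal inv v
        (galoisCohomology.map (φ.restrictField (Place.Completion v)) 1 a)
        (galoisCohomology.map (φ.restrictField (Place.Completion v)) 1 b) =
      invWeilPairing W₀ n e₀ hμ₀ hadd₁₀ hadd₂₀ hgal₀ inv v a b := by
  rw [invWeilPairing_apply, invWeilPairing_apply]
  congr 1
  have h := ContPairing.cupProduct_map (weilContPairingLocal W₀ n e₀ hμ₀ hadd₁₀ hadd₂₀ hgal₀ v)
    (weilContPairingLocal W n e hμ hadd₁ hadd₂ hgal v)
    (DiscreteGaloisModule.homOfIntertwining (φ.restrictField (Place.Completion v)))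
    (DiscreteGaloisModule.homOfIntertwining (φ.restrictField (Place.Completion v)))
    (𝟙 _) (fun S T ↦ by
      change weilPairingHom W₀ n e₀ hμ₀ hadd₁₀ hadd₂₀ S T = weilPairingHom W n e hμ hadd₁ hadd₂ (φ S) (φ T)
      rw [muCarrier_eq_iff, coe_weilPairingHom, coe_weilPairingHom, he]) a b
  have h1 : cohomologyMap (𝟙 ((mu K n).toLocal v).toTopRep) 2 = 𝟙 _ := map_id_eq_id _ (fun _ ↦ rfl) 2
  rw [h1] at h
  exact h.symm


omit [NumberField K] [W.IsElliptic] [W₀.IsElliptic] [NeZero n] in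
/-- A morphism of the torsion Galois modules is `Γ_K`-equivariant on points. [folklore] -/
theorem contIntertwiningMap_smul (σ : absoluteGaloisGroup K) (S : W₀.geomTorsion n) : φ (σ • S) = σ • φ S := by
  have h := ContIntertwiningMap.isIntertwining φ σ S
  simpa only [ContinuousRep.toContRepresentation_apply_apply, torsionGaloisModule_apply_apply] using h

omit [W.IsElliptic] in
/-- **The transported Kummer condition is ISOTROPIC for every Weil pairing of `E`.** For a morphism `φ : E₀[n] → E[n]` of
discrete `Γ_K`-modules and ANY Weil pairing datum `e` on `E[n]` (alternating), the image `φ_*(𝓚^{E₀}_v) ≤ H¹(K_v, E[n])` of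
E₀'s local Kummer condition is isotropic for `inv_v(· ∪ₑ ·)`: transport along `φ` (§1, for the pulled-back datum `e ∘ (φ × φ)`,
again a Weil datum on `E₀[n]`) and the isotropy of `𝓚^{E₀}_v` for it (Poonen–Rains, X11b `invWeilPairing_eq_zero_of_mem`).
No compatibility of `φ` with given pairings is needed. [cite: PoonenRains2012, Prop. 4.10] [cite: NeukirchSchmidtWingberg2008, I §4 (1.4.2)] -/
theorem invWeilPairing_eq_zero_of_mem_map_kummer
    [∀ v : Place K, CompactSpace (absoluteGaloisGroup (Place.Completion v))] [Finite (W₀.geomTorsion n)]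
    (halt : ∀ T, e T T = 1) (v : Place K)
    {x y : galoisCohomology ((W.torsionGaloisModule n).toLocal v) 1}
    (hx : x ∈ (W₀.kummerSelmerStructure n v).map (galoisCohomology.map (φ.restrictField (Place.Completion v)) 1))
    (hy : y ∈ (W₀.kummerSelmerStructure n v).map (galoisCohomology.map (φ.restrictField (Place.Completion v)) 1)) :
    invWeilPairing W n e hμ hadd₁ hadd₂ hgal inv v x y = 0 := by
  obtain ⟨a, ha, rfl⟩ := hx
  obtain ⟨b, hb, rfl⟩ := hy
  have hφ : ∀ (σ : absoluteGaloisGroup K) (S : W₀.geomTorsion n), φ (σ • S) = σ • φ S :=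
    contIntertwiningMap_smul W W₀ n φ
  rw [invWeilPairing_map_map W W₀ n e hμ hadd₁ hadd₂ hgal (fun S T ↦ e (φ S) (φ T)) (fun S T ↦ hμ _ _)
    (fun S₁ S₂ T ↦ by rw [map_add, hadd₁]) (fun S T₁ T₂ ↦ by rw [map_add, hadd₂])
    (fun σ S T ↦ by rw [hgal, hφ, hφ]) inv φ (fun S T ↦ rfl) v a b]
  exact invWeilPairing_eq_zero_of_mem W₀ n _ _ _ _ _ (fun T ↦ halt _) inv v ha hb

omit [W.IsElliptic] [W₀.IsElliptic] [NeZero n] in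
/-- **`φ_*` is injective on `H¹(K_v, ·)` when `φ` has a left inverse `ψ`**, hence the transported Kummer condition is non-zero as
soon as E₀'s is. [cite: SerreGaloisCohomology1997, I §2.2] -/
theorem map_kummer_ne_bot
    (ψ : (W.torsionGaloisModule n).toContRepresentation →ⁱL (W₀.torsionGaloisModule n).toContRepresentation)
    (hψφ : ∀ a, ψ (φ a) = a) (v : Place K) (h0 : W₀.kummerSelmerStructure n v ≠ ⊥) :
    (W₀.kummerSelmerStructure n v).map (galoisCohomology.map (φ.restrictField (Place.Completion v)) 1) ≠ ⊥ := by
  intro h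
  apply h0
  rw [eq_bot_iff] at h ⊢
  intro x hx
  have hx' := h (AddSubgroup.mem_map_of_mem _ hx)
  rw [AddSubgroup.mem_bot] at hx' ⊢
  exact Levels.map_injective_of_comp_eq (φ.restrictField (Place.Completion v)) (ψ.restrictField (Place.Completion v))
    hψφ (hx'.trans (map_zero _).symm)

omit [W.IsElliptic] [W₀.IsElliptic] [NeZero n] in
/-- **`#H¹(K_v, E₀[n]) = #H¹(K_v, E[n])`** along an isomorphism `φ` of the torsion modules (inverse `ψ`). [folklore] -/
theorem natCard_localH1_eq_of_iso
    (ψ : (W.torsionGaloisModule n).toContRepresentation →ⁱL (W₀.torsionGaloisModule n).toContRepresentation)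
    (hψφ : ∀ a, ψ (φ a) = a) (hφψ : ∀ b, φ (ψ b) = b) (v : Place K) :
    Nat.card (galoisCohomology ((W₀.torsionGaloisModule n).toLocal v) 1) =
      Nat.card (galoisCohomology ((W.torsionGaloisModule n).toLocal v) 1) :=
  Nat.card_congr
    { toFun := galoisCohomology.map (φ.restrictField (Place.Completion v)) 1
      invFun := galoisCohomology.map (ψ.restrictField (Place.Completion v)) 1
      left_inv := fun x ↦ Levels.map_map_eq_self_of_comp_eq (φ.restrictField (Place.Completion v))
        (ψ.restrictField (Place.Completion v)) hψφ x
      right_inv := fun y ↦ Levels.map_map_eq_self_of_comp_eq (ψ.restrictField (Place.Completion v))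
        (φ.restrictField (Place.Completion v)) hφψ y }

omit [W.IsElliptic] [W₀.IsElliptic] [NeZero n] in
/-- **Naturality**: `loc_v (φ_* y) = φ_{v,*} (loc_v y)`. [folklore] -/
theorem localization_map (v : Place K) (y : galoisCohomology (W₀.torsionGaloisModule n) 1) :
    galoisCohomology.localization (W.torsionGaloisModule n) v 1 (galoisCohomology.map φ 1 y) =
      galoisCohomology.map (φ.restrictField (Place.Completion v)) 1
        (galoisCohomology.localization (W₀.torsionGaloisModule n) v 1 y) :=
  galoisCohomology.res_map_one (Place.Completion v) φ y

end Transport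

/-! ## §2 The order of E's Kummer LINE at a plane place; the transported Kummer line equals E's (the (A1) shape from a torsion congruence) -/

section Congruence

variable (p : ℕ) [Fact p.Prime]

/-- **`#𝓚_v = p` at a PLANE place**: for `p ≠ 2`, a perfect family `inv` and a finite place `w₀` with `#H¹(K_{w₀}, E[p]) = p²`, E's
Kummer condition at `w₀` has order `p` (it is LAGRANGIAN: `#𝓚² = #H¹`, jump file §2). [cite: PoonenRains2012, Prop. 4.10]
[cite: MilneADT2006, Ch. I, Cor. 2.3, Thm. 2.8] -/
theorem natCard_kummerSelmerStructure_eq (hp2 : p ≠ 2) (inv : LocalInvariants K (p ^ 1)) (hperf : inv.IsPerfect)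
    (w₀ : HeightOneSpectrum (𝓞 K))
    (hH : Nat.card (galoisCohomology ((W.torsionGaloisModule ((p ^ 1 : ℕ) : ℤ)).toLocal (Sum.inr w₀ : Place K)) 1) = p ^ 2) :
    Nat.card (W.kummerSelmerStructure ((p ^ 1 : ℕ) : ℤ) (Sum.inr w₀)) = p := by
  have hp : p.Prime := Fact.out
  haveI : NeZero (p ^ 1 : ℕ) := ⟨pow_ne_zero 1 hp.ne_zero⟩
  have hp1 : IsPrimePow (p ^ 1 : ℕ) := hp.isPrimePow.pow one_ne_zero
  have hodd : Odd (p ^ 1 : ℕ) := (hp.odd_of_ne_two hp2).pow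
  haveI : PerfectField K := PerfectField.ofCharZero
  haveI : ∀ v : Place K, CompactSpace (absoluteGaloisGroup (Place.Completion v)) := fun v ↦
    absoluteGaloisGroup_compactSpace _
  haveI : Finite (W.geomTorsion ((p ^ 1 : ℕ) : ℤ)) := finite_geomTorsion_of_neZero W (p ^ 1)
  haveI : Finite (galoisCohomology ((W.torsionGaloisModule ((p ^ 1 : ℕ) : ℤ)).toLocal (Sum.inr w₀ : Place K)) 1) :=
    Nat.finite_of_card_ne_zero (by rw [hH]; exact pow_ne_zero 2 hp.ne_zero)
  obtain ⟨e, hμ, hadd₁, hadd₂, halt, hnondeg, hgal⟩ :=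
    exists_weilPairing_holds W (p ^ 1) (by rw [pow_one]; exact hp.two_le) (by exact_mod_cast pow_ne_zero 1 hp.ne_zero)
  have hA : ∀ x : galoisCohomology ((W.torsionGaloisModule ((p ^ 1 : ℕ) : ℤ)).toLocal (Sum.inr w₀ : Place K)) 1,
      (p ^ 1) • x = 0 :=
    nsmul_continuousCohomology_one_eq_zero _ (p ^ 1)
      (fun T : W.geomTorsion ((p ^ 1 : ℕ) : ℤ) ↦ AddSubgroup.torsionBy.nsmul T)
  have hbij : Bijective (invWeilPairing W (p ^ 1) e hμ hadd₁ hadd₂ hgal inv (Sum.inr w₀)) :=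
    invWeilPairing_bijective W (p ^ 1) e hμ hadd₁ hadd₂ hgal hnondeg inv w₀ (hperf w₀).1.1
  have hflip : Bijective (invWeilPairing W (p ^ 1) e hμ hadd₁ hadd₂ hgal inv (Sum.inr w₀)).flip := by
    have h : (invWeilPairing W (p ^ 1) e hμ hadd₁ hadd₂ hgal inv (Sum.inr w₀)).flip =
        invWeilPairing W (p ^ 1) e hμ hadd₁ hadd₂ hgal inv (Sum.inr w₀) := by
      ext x y
      exact invWeilPairing_symm W (p ^ 1) e hμ hadd₁ hadd₂ hgal halt inv _ y x
    rw [h]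
    exact hbij
  have h := natCard_annRight_mul hA _ hflip (W.kummerSelmerStructure ((p ^ 1 : ℕ) : ℤ) (Sum.inr w₀))
  rw [annRight_kummer_eq_of_odd W (p ^ 1) e hμ hadd₁ hadd₂ hgal halt hnondeg inv hp1 hodd hperf _, hH] at h
  have h' : Nat.card (W.kummerSelmerStructure ((p ^ 1 : ℕ) : ℤ) (Sum.inr w₀)) ^ 2 = p ^ 2 := by
    rw [sq]; exact h
  exact Nat.pow_left_injective two_ne_zero h'

/-- **THE (A1) SHAPE FROM A TORSION CONGRUENCE.** `E = W`, `E₀ = W₀` elliptic curves over ANY number field `K`, `p ≠ 2`, the named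
Poitou–Tate fact (DUAL.2), an ISOMORPHISM `φ : E₀[p] ≅ E[p]` of discrete `Γ_K`-modules (inverse `ψ`), a finite place `w₀` with
`#H¹(K_{w₀}, E[p]) = p²` (PLANE; `E(K_{w₀})[p] = 0` at `w₀ ∣ p` with `[K_{w₀} : ℚ_p] = 1`). If the Selmer groups of `𝓚^E` and of
`𝓚^E[w₀ ↦ φ_*𝓚^{E₀}_{w₀}]` (E's Kummer conditions off `w₀`, E₀'s transported Kummer condition at `w₀`) have orders `p^a`, `p^b` with
`a ≡ b (mod 2)`, then **`φ_*𝓚^{E₀}_{w₀} = 𝓚^E_{w₀}`**: the transported Kummer line IS E's Kummer line at `w₀`. (The switch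
`eq_kummer_of_isotropic_of_even_iff` with isotropy from §1 for EVERY Weil datum and non-vanishing from `#𝓚^{E₀}_{w₀} = p`.)
For a transfer line on KS′: `a` = dim Sel_p(E/ℚ), `b` = dim Sel_𝔭(lender) once (θK) holds off `p`; `a ≡ b` by `p`-parity twice
and `w(E) = w(lender)`. [cite: PoonenRains2012, Prop. 4.11] [cite: DokchitserDokchitserAnnals2010, Thm. 1.4] -/
theorem map_kummer_eq_kummer_of_even_iff (hp2 : p ≠ 2) (hPT : poitouTate_selmerStructure_duality K)
    (φ : (W₀.torsionGaloisModule ((p ^ 1 : ℕ) : ℤ)).toContRepresentation →ⁱL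
      (W.torsionGaloisModule ((p ^ 1 : ℕ) : ℤ)).toContRepresentation)
    (ψ : (W.torsionGaloisModule ((p ^ 1 : ℕ) : ℤ)).toContRepresentation →ⁱL
      (W₀.torsionGaloisModule ((p ^ 1 : ℕ) : ℤ)).toContRepresentation)
    (hψφ : ∀ a, ψ (φ a) = a) (hφψ : ∀ b, φ (ψ b) = b) (w₀ : HeightOneSpectrum (𝓞 K))
    (hH : Nat.card (galoisCohomology ((W.torsionGaloisModule ((p ^ 1 : ℕ) : ℤ)).toLocal (Sum.inr w₀ : Place K)) 1) = p ^ 2)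
    (hpar : ∃ a b : ℕ, Nat.card (W.kummerSelmerStructure ((p ^ 1 : ℕ) : ℤ)).selmerGroup = p ^ a ∧
      Nat.card (SelmerStructure.selmerGroup (Function.update (W.kummerSelmerStructure ((p ^ 1 : ℕ) : ℤ)) (Sum.inr w₀)
        ((W₀.kummerSelmerStructure ((p ^ 1 : ℕ) : ℤ) (Sum.inr w₀)).map
          (galoisCohomology.map (φ.restrictField (Place.Completion (Sum.inr w₀ : Place K))) 1)) :
            SelmerStructure (W.torsionGaloisModule ((p ^ 1 : ℕ) : ℤ)))) = p ^ b ∧ (Even a ↔ Even b)) :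
    (W₀.kummerSelmerStructure ((p ^ 1 : ℕ) : ℤ) (Sum.inr w₀)).map
        (galoisCohomology.map (φ.restrictField (Place.Completion (Sum.inr w₀ : Place K))) 1) =
      W.kummerSelmerStructure ((p ^ 1 : ℕ) : ℤ) (Sum.inr w₀) := by
  have hp : p.Prime := Fact.out
  haveI : NeZero (p ^ 1 : ℕ) := ⟨pow_ne_zero 1 hp.ne_zero⟩
  haveI : Finite (W₀.geomTorsion ((p ^ 1 : ℕ) : ℤ)) := finite_geomTorsion_of_neZero W₀ (p ^ 1)
  -- E₀'s Kummer line at `w₀` is non-zero: `#𝓚^{E₀}_{w₀} = p` (plane for `E₀` by transport of the count)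
  have hH₀ : Nat.card (galoisCohomology ((W₀.torsionGaloisModule ((p ^ 1 : ℕ) : ℤ)).toLocal (Sum.inr w₀ : Place K)) 1) =
      p ^ 2 := (natCard_localH1_eq_of_iso W W₀ (p ^ 1) φ ψ hψφ hφψ _).trans hH
  obtain ⟨inv, hperf, -, -, -⟩ := hPT (p ^ 1)
  have h0 : W₀.kummerSelmerStructure ((p ^ 1 : ℕ) : ℤ) (Sum.inr w₀) ≠ ⊥ := by
    intro h
    have hc := natCard_kummerSelmerStructure_eq W₀ p hp2 inv hperf w₀ hH₀
    rw [h, AddSubgroup.card_bot] at hc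
    exact hp.one_lt.ne hc
  refine eq_kummer_of_isotropic_of_even_iff W p hp2 hPT w₀ hH _ ?_
    (map_kummer_ne_bot W W₀ (p ^ 1) φ ψ hψφ _ h0) hpar
  intro _ inv' e hμ hadd₁ hadd₂ hgal _ halt _ x hx y hy
  exact invWeilPairing_eq_zero_of_mem_map_kummer W W₀ (p ^ 1) e hμ hadd₁ hadd₂ hgal inv' φ halt _ hx hy

omit [W.IsElliptic] [W₀.IsElliptic] in
/-- **The (θK) binder at `w₀` for GLOBAL classes**, from the local identity: if `φ_*𝓚^{E₀}_{w₀} = 𝓚^E_{w₀}` (e.g. by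
`map_kummer_eq_kummer_of_even_iff`) and `φ` has a left inverse, then a global class `y ∈ H¹(K, E₀[p])` satisfies E₀'s Kummer
condition at `w₀` iff `φ_* y` satisfies E's (naturality `loc ∘ φ_* = φ_{w₀,*} ∘ loc` and injectivity of `φ_{w₀,*}`) — the shape of
the binder (θK) at `v ∣ p` of the transfer socket `nonempty_levelKolyvaginSystemP_of_torsionCongr`, in Selmer-structure currency.
[cite: SerreGaloisCohomology1997, I §2.4] -/
theorem localization_map_mem_kummer_iff {n : ℕ}
    (φ : (W₀.torsionGaloisModule n).toContRepresentation →ⁱL (W.torsionGaloisModule n).toContRepresentation)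
    (ψ : (W.torsionGaloisModule n).toContRepresentation →ⁱL (W₀.torsionGaloisModule n).toContRepresentation)
    (hψφ : ∀ a, ψ (φ a) = a) (v : Place K)
    (heq : (W₀.kummerSelmerStructure n v).map (galoisCohomology.map (φ.restrictField (Place.Completion v)) 1) =
      W.kummerSelmerStructure n v)
    (y : galoisCohomology (W₀.torsionGaloisModule n) 1) :
    galoisCohomology.localization (W.torsionGaloisModule n) v 1 (galoisCohomology.map φ 1 y) ∈
        W.kummerSelmerStructure n v ↔
      galoisCohomology.localization (W₀.torsionGaloisModule n) v 1 y ∈ W₀.kummerSelmerStructure n v := by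
  rw [localization_map W W₀ n φ v y, ← heq]
  constructor
  · rintro ⟨z, hz, hzy⟩
    have hinj := Levels.map_injective_of_comp_eq (φ.restrictField (Place.Completion v)) (ψ.restrictField (Place.Completion v))
      hψφ
    rwa [← hinj hzy]
  · exact fun h ↦ AddSubgroup.mem_map_of_mem _ h

end Congruence

end Summit.BirchSwinnertonDyer.BirchSwinnertonDyer.Theorems.AdditiveKoly.LagrangianSwitchAtP

end
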